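import Literature.NumberTheory.EllipticCurves.ModularSymbolsManin
import Mathlib.LinearAlgebra.Dual.Lemmas
import HarnessLib

/-!
# Weight-`k` Manin symbols of a finite-index subgroup of `SL(2, ℤ)`: the formal module, its
# relations, and the dimension count `12 dim ≤ (k - 1)[SL(2, ℤ) : Γ]`

This is the first, purely algebraic, file of the rank half of the Eichler–Shimura isomorphism for
`Γ₁(N)` in weight `k = n + 2 ≥ 3` (Shimura 1971, Thm. 8.4 and (8.2.23):
`dim_ℝ H¹_P(Γ, V_n) = 2 dim_ℂ S_{n+2}(Γ)`), in the form the tree needs it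
(`heckeStableRealLatticeOfGenerators` of `EichlerShimuraPeriodsGamma1RealSpanProofs`:
the period lattice `periodLatticeK1 n` of `S_{n+2}(Γ₁(N))` is generated by `2 dim_ℂ S_{n+2}(Γ₁(N))`
elements).  It is the weight-`k` analogue of the counting half of `ModularSymbolsManin`
(weight `2`, `Γ₀(N)`), organised as in Merel 1994, §1.2–1.3:

* **A1. The six-term count** (`SixTerm`, pure linear algebra).  For endomorphisms `s, u, ι` of a
  finite-dimensional `ℚ`-vector space `M` with `ι² = 1`, `s² = ι`, `u³ = ι` (the relations of
  `S`, `TS`, `-1` in `SL(2, ℤ) = ℤ/4 *_{ℤ/2} ℤ/6`) and the relation module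
  `rel = (1 + s)M + (1 + u + u²)M + (1 - ι)M`,
  `12 dim(M/rel) ≤ dim M + tr ι - 3(tr s + tr sι) - 2(tr u + tr uι) - 2(tr u² + tr u²ι) + 12 dim fix`
  (`SixTerm.IsSixTerm.twelve_mul_finrank_quotient_le`), where `fix = M₊ ∩ ker(s - 1) ∩ ker(u - 1)`,
  `M₊ = ker(ι - 1)`: on `M₊`, `(1 + s)/2` and `(1 + u + u²)/3` are the projections onto the
  invariants (ranks = traces) and the two ranges meet inside `fix` (Merel 1994, Prop. 3: "the
  kernel of `m_k` is the sum of the `σ`-invariants and the `τ`-invariants", whose intersection is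
  `{0}` if `k > 2`).
* **A2. The Manin module** (`ManinK`).  `W_n = polyFun n`, the `ℚ`-span of the monomial functions
  `q₀ʲq₁^{n-j}` on `ℤ²` (a model of `Symⁿ`), with `SL(2, ℤ)` acting by precomposition;
  `V_n = W_n^*` with the transposed (covariant) action `ρ`, `ρ(g) ev_q = ev_{gq}` (`rho_ev`), spanned
  by the evaluations `ev_q` (`span_ev`); the formal module `M = (SL(2, ℤ)/Γ → V_n)` of Manin
  symbols `[gΓ, v]` with the operators `g^* F(x) = ρ(g⁻¹)F(gx)` of `S`, `TS`, `-1`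
  (`sOp`, `uOp`, `iOp`; `isSixTerm`) and the relation module `relK n Γ` (two-term, three-term,
  sign; Merel 1994, Prop. 1).  Proved:
  - `fix_eq_bot` — **no invariants for `n ≥ 1`** (`V_n^Γ = 0`: `dual_eq_zero_of_invariant`, a
    triangular argument with the unipotents `T^w, S⁻¹T^{w'}S ∈ Γ`; Merel, proof of Prop. 3:
    "this implies that `P_j` is a constant polynomial, i.e. `P = 0` or `k = 2`");
  - `trace_gOp_eq_zero` — `tr g^* = 0` when `g` fixes no coset;
  - `twelve_mul_finrank_quotient_le` — **`12 dim_ℚ(M/rel) ≤ (n + 1)[SL(2, ℤ) : Γ]`** for `n ≥ 1`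
    when no conjugate of `-1, ±S, ±TS, ±(TS)²` lies in `Γ` (no `-1`, no elliptic elements; e.g.
    `Γ₁(N)`, `N ≥ 4`) — the value `(n+1)μ̄/6`, `μ̄ = [PSL(2, ℤ) : Γ̄]`, which is Shimura's
    (8.2.24) for `dim H¹_P` plus one boundary (Eisenstein) class per cusp;
  - `PolySymbol` — a **system of Manin symbols** with values in a `ℚ`-module `E`: functions
    `[x, q] ∈ E` (`x ∈ SL(2, ℤ)/Γ`, `q ∈ ℤ²`), polynomial of degree `n` in `q`, satisfying the
    two-term, three-term and sign relations at the level of `q`; such a system factors through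
    `M/rel` (`PolySymbol.total`, `relK_le_ker`, `total_single`), hence
    **`12 dim_ℚ span{[x, q]} ≤ (n + 1)[SL(2, ℤ) : Γ]`** (`PolySymbol.twelve_mul_finrank_span_le`).

The sequel applies this to the periods `[gΓ₁(N), q] = ∫_{g⁻¹0}^{g⁻¹∞} f(z)((g⁻¹q)₁ z - (g⁻¹q)₀)ⁿ dz`
of `S_{n+2}(Γ₁(N))` (a `PolySymbol` by the cocycle relations of `periodFn1`,
`EichlerShimuraPeriodsGamma1`), Manin's continued-fraction trick, the boundary map and a
Manin–Drinfeld argument for the cusps above `∞`.  Everything here is proved; there are no named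
facts.

## References

* L. Merel, *Universal Fourier expansions of modular forms*, in: On Artin's conjecture for odd
  2-dimensional representations, LNM 1585, Springer 1994, 59–94: §1.1 (modular symbols of weight
  `k`), §1.2 Prop. 1 (Manin symbols, two- and three-term and `J` relations), §1.3 Prop. 3 (the kernel
  of `P[Γg] ↦ [P, g]` is `σ`-invariants + `τ`-invariants, meeting in `0` for `k > 2`).
* G. Shimura, *Introduction to the arithmetic theory of automorphic functions*, Publ. Math. Soc.
  Japan 11 (1971), §8.1–8.2: Thm. 8.4, (8.2.23), (8.2.24) (`dim H¹_P(Γ, X)`).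
* J. E. Cremona, *Algorithms for modular elliptic curves*, 2nd ed. (1997), §2.1–2.2 (weight `2`).
-/

noncomputable section


open Module LinearMap

namespace Literature.NumberTheory.EllipticCurves.ModularForms

namespace SixTerm

variable {M : Type*} [AddCommGroup M] [Module ℚ M]

/-- The data of the six-term count: endomorphisms `s, u, ι` with `ι² = 1`, `s² = ι`, `u³ = ι`
(the images of `S`, `TS`, `-1 ∈ SL(2, ℤ)` in a representation: `S² = (TS)³ = -1`). [folklore] -/
structure IsSixTerm (s u ι : M →ₗ[ℚ] M) : Prop where
  iota_comp : ι ∘ₗ ι = LinearMap.id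
  s_comp : s ∘ₗ s = ι
  u_comp : u ∘ₗ (u ∘ₗ u) = ι

variable (s u ι : M →ₗ[ℚ] M)

/-- The `+1`-eigenspace `M₊ = ker(ι - 1)` of the involution `ι`. [folklore] -/
def plus : Submodule ℚ M := LinearMap.ker (ι - LinearMap.id)

/-- The relation module `range(1 + s) + range(1 + u + u²) + range(1 - ι)`. [folklore] -/
def rel : Submodule ℚ M :=
  LinearMap.range (LinearMap.id + s) ⊔ LinearMap.range (LinearMap.id + u + u ∘ₗ u) ⊔
    LinearMap.range (LinearMap.id - ι)

/-- The common fixed vectors of `s`, `u` in `M₊` (the invariants of the group generated). [folklore] -/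
def fix : Submodule ℚ M :=
  plus ι ⊓ LinearMap.ker (s - LinearMap.id) ⊓ LinearMap.ker (u - LinearMap.id)

/-- The part of the relation module inside `M₊`: `(1 + s)M₊ + (1 + u + u²)M₊`. [folklore] -/
def relPlus : Submodule ℚ M :=
  (plus ι).map (LinearMap.id + s) ⊔ (plus ι).map (LinearMap.id + u + u ∘ₗ u)

variable {s u ι}

/-- Membership in `M₊`. [folklore] -/
@[simp] theorem mem_plus {m : M} : m ∈ plus ι ↔ ι m = m := by
  simp [plus, sub_eq_zero]

/-- Membership in `fix`. [folklore] -/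
theorem mem_fix {m : M} : m ∈ fix s u ι ↔ ι m = m ∧ s m = m ∧ u m = m := by
  simp [fix, plus, sub_eq_zero, and_assoc]

variable (ι) in
/-- The projection `π₊ = (1 + ι)/2` onto `M₊` along `(1 - ι)M`. [folklore] -/
def projPlus : M →ₗ[ℚ] M := (1 / 2 : ℚ) • (LinearMap.id + ι)

/-- Unfolding `π₊`. [folklore] -/
theorem projPlus_apply (m : M) : projPlus ι m = (1 / 2 : ℚ) • (m + ι m) := rfl

/-- `π₊` is the identity on `M₊`. [folklore] -/
theorem projPlus_of_mem {m : M} (hm : m ∈ plus ι) : projPlus ι m = m := by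
  rw [projPlus_apply, mem_plus.mp hm]
  module

namespace IsSixTerm

variable (h : IsSixTerm s u ι)
include h

/-- `ι² = 1` pointwise. [folklore] -/
theorem iota_apply (m : M) : ι (ι m) = m := LinearMap.congr_fun h.iota_comp m

/-- `s² = ι` pointwise. [folklore] -/
theorem s_apply (m : M) : s (s m) = ι m := LinearMap.congr_fun h.s_comp m

/-- `u³ = ι` pointwise. [folklore] -/
theorem u_apply (m : M) : u (u (u m)) = ι m := LinearMap.congr_fun h.u_comp m

/-- `s ι = ι s` (`s³` computed two ways). [folklore] -/
theorem s_iota (m : M) : s (ι m) = ι (s m) := by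
  rw [← h.s_apply m, h.s_apply (s m)]

/-- `u ι = ι u` (`u⁴` computed two ways). [folklore] -/
theorem u_iota (m : M) : u (ι m) = ι (u m) := by
  rw [← h.u_apply m, h.u_apply (u m)]

/-- `s` preserves `M₊`. [folklore] -/
theorem s_mem_plus {m : M} (hm : m ∈ plus ι) : s m ∈ plus ι := by
  rw [mem_plus] at hm ⊢
  rw [← h.s_iota, hm]

/-- `u` preserves `M₊`. [folklore] -/
theorem u_mem_plus {m : M} (hm : m ∈ plus ι) : u m ∈ plus ι := by
  rw [mem_plus] at hm ⊢
  rw [← h.u_iota, hm]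

/-- On `M₊`, `s` is an involution. [folklore] -/
theorem s_s_of_mem {m : M} (hm : m ∈ plus ι) : s (s m) = m := by
  rw [h.s_apply, mem_plus.mp hm]

/-- On `M₊`, `u` has order `3`. [folklore] -/
theorem u_u_u_of_mem {m : M} (hm : m ∈ plus ι) : u (u (u m)) = m := by
  rw [h.u_apply, mem_plus.mp hm]

/-- `M₊ ∩ (1 - ι)M = 0`. [folklore] -/
theorem plus_inf_range_eq_bot : plus ι ⊓ LinearMap.range (LinearMap.id - ι) = ⊥ := by
  rw [eq_bot_iff]
  rintro m ⟨hm, ⟨m', rfl⟩⟩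
  have hm' : ι (m' - ι m') = m' - ι m' := mem_plus.mp hm
  rw [map_sub, h.iota_apply] at hm'
  have h2 : (2 : ℚ) • (m' - ι m') = 0 := by
    rw [two_smul]
    nth_rewrite 1 [← hm']
    abel
  rw [Submodule.mem_bot]
  simpa using h2

/-- `M = M₊ + (1 - ι)M`. [folklore] -/
theorem plus_sup_range_eq_top : plus ι ⊔ LinearMap.range (LinearMap.id - ι) = ⊤ := by
  rw [eq_top_iff]
  intro m _
  have hdec : m = (1 / 2 : ℚ) • (m + ι m) + (LinearMap.id - ι : M →ₗ[ℚ] M) ((1 / 2 : ℚ) • m) := by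
    simp only [LinearMap.sub_apply, LinearMap.id_apply, map_smul]
    module
  rw [hdec]
  refine Submodule.add_mem_sup ?_ ⟨_, rfl⟩
  rw [mem_plus, map_smul, map_add, h.iota_apply, add_comm]

/-- `relPlus ≤ M₊`. [folklore] -/
theorem relPlus_le_plus : relPlus s u ι ≤ plus ι := by
  refine sup_le ?_ ?_
  · rintro _ ⟨m, hm, rfl⟩
    simp only [LinearMap.add_apply, LinearMap.id_apply]
    exact add_mem hm (h.s_mem_plus hm)
  · rintro _ ⟨m, hm, rfl⟩
    simp only [LinearMap.add_apply, LinearMap.id_apply, LinearMap.comp_apply]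
    exact add_mem (add_mem hm (h.u_mem_plus hm)) (h.u_mem_plus (h.u_mem_plus hm))

/-- `rel = relPlus + (1 - ι)M`. [folklore] -/
theorem rel_eq : rel s u ι = relPlus s u ι ⊔ LinearMap.range (LinearMap.id - ι) := by
  apply le_antisymm
  · refine sup_le (sup_le ?_ ?_) le_sup_right
    · rintro _ ⟨m, rfl⟩
      have hdec : (LinearMap.id + s : M →ₗ[ℚ] M) m =
          (LinearMap.id + s : M →ₗ[ℚ] M) ((1 / 2 : ℚ) • (m + ι m)) +
            (LinearMap.id - ι : M →ₗ[ℚ] M) ((LinearMap.id + s : M →ₗ[ℚ] M) ((1 / 2 : ℚ) • m)) := by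
        simp only [LinearMap.add_apply, LinearMap.sub_apply, LinearMap.id_apply, map_smul, map_add]
        rw [h.s_iota]
        module
      rw [hdec]
      refine Submodule.add_mem_sup (Submodule.mem_sup_left ⟨_, ?_, rfl⟩) ⟨_, rfl⟩
      change _ ∈ plus ι
      rw [mem_plus, map_smul, map_add, h.iota_apply, add_comm]
    · rintro _ ⟨m, rfl⟩
      have hdec : (LinearMap.id + u + u ∘ₗ u : M →ₗ[ℚ] M) m =
          (LinearMap.id + u + u ∘ₗ u : M →ₗ[ℚ] M) ((1 / 2 : ℚ) • (m + ι m)) +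
            (LinearMap.id - ι : M →ₗ[ℚ] M)
              ((LinearMap.id + u + u ∘ₗ u : M →ₗ[ℚ] M) ((1 / 2 : ℚ) • m)) := by
        simp only [LinearMap.add_apply, LinearMap.sub_apply, LinearMap.id_apply, map_smul, map_add,
          LinearMap.comp_apply]
        rw [h.u_iota, h.u_iota]
        module
      rw [hdec]
      refine Submodule.add_mem_sup (Submodule.mem_sup_right ⟨_, ?_, rfl⟩) ⟨_, rfl⟩
      change _ ∈ plus ι
      rw [mem_plus, map_smul, map_add, h.iota_apply, add_comm]
  · refine sup_le (sup_le ?_ ?_) le_sup_right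
    · exact (LinearMap.map_le_range).trans (le_sup_left.trans le_sup_left)
    · exact (LinearMap.map_le_range).trans (le_sup_right.trans le_sup_left)

/-- `(1 + s)M₊ ∩ (1 + u + u²)M₊ ≤ fix`. [folklore] -/
theorem inf_le_fix :
    (plus ι).map (LinearMap.id + s) ⊓ (plus ι).map (LinearMap.id + u + u ∘ₗ u) ≤ fix s u ι := by
  rintro y ⟨⟨m, hm, rfl⟩, ⟨m', hm', hy⟩⟩
  rw [mem_fix]
  refine ⟨mem_plus.mp (h.relPlus_le_plus (Submodule.mem_sup_left ⟨m, hm, rfl⟩)), ?_, ?_⟩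
  · simp only [LinearMap.add_apply, LinearMap.id_apply, map_add]
    rw [h.s_s_of_mem hm, add_comm]
  · rw [← hy]
    simp only [LinearMap.add_apply, LinearMap.id_apply, LinearMap.comp_apply, map_add]
    rw [h.u_u_u_of_mem hm']
    abel


/-! ### Traces of restrictions to `M₊` -/

/-- `π₊` takes values in `M₊`. [folklore] -/
theorem projPlus_mem (m : M) : projPlus ι m ∈ plus ι := by
  rw [mem_plus, projPlus_apply, map_smul, map_add, h.iota_apply, add_comm]

/-- `π₊` is idempotent. [folklore] -/
theorem projPlus_comp_projPlus : projPlus ι ∘ₗ projPlus ι = projPlus ι := by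
  ext m
  exact projPlus_of_mem (h.projPlus_mem m)

/-- `range π₊ = M₊`. [folklore] -/
theorem range_projPlus : LinearMap.range (projPlus ι) = plus ι := by
  apply le_antisymm
  · rintro _ ⟨m, rfl⟩
    exact h.projPlus_mem m
  · intro m hm
    exact ⟨m, projPlus_of_mem hm⟩

variable [FiniteDimensional ℚ M]

/-- `trace π₊ = dim M₊`. [folklore] -/
theorem trace_projPlus : LinearMap.trace ℚ M (projPlus ι) = finrank ℚ (plus ι) := by
  have := ManinCount.trace_eq_mul_finrank_range (projPlus ι) one_ne_zero
    (by rw [one_smul]; exact h.projPlus_comp_projPlus)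
  rw [this, one_mul, h.range_projPlus]

/-- `2 dim M₊ = trace 1 + trace ι = dim M + trace ι`. [folklore] -/
theorem two_mul_finrank_plus :
    2 * (finrank ℚ (plus ι) : ℚ) = finrank ℚ M + LinearMap.trace ℚ M ι := by
  rw [← h.trace_projPlus, projPlus, map_smul, map_add, LinearMap.trace_id, smul_eq_mul]
  ring

/-- **The trace of a restriction to `M₊`** of an endomorphism `f` preserving `M₊` is the trace of
`f ∘ π₊` on `M`, i.e. `(trace f + trace (f ∘ ι))/2`. [folklore] -/
theorem trace_restrict_eq (f : M →ₗ[ℚ] M) (hf : ∀ m ∈ plus ι, f m ∈ plus ι) :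
    LinearMap.trace ℚ (plus ι) (f.restrict hf) =
      (1 / 2 : ℚ) * (LinearMap.trace ℚ M f + LinearMap.trace ℚ M (f ∘ₗ ι)) := by
  set π' : M →ₗ[ℚ] plus ι := LinearMap.codRestrict (plus ι) (projPlus ι) h.projPlus_mem with hπ'
  have h1 : f.restrict hf = π' ∘ₗ (f ∘ₗ (plus ι).subtype) := by
    ext ⟨m, hm⟩
    simp only [LinearMap.coe_restrict_apply, hπ', LinearMap.coe_comp, Submodule.coe_subtype,
      Function.comp_apply, LinearMap.codRestrict_apply]
    exact (projPlus_of_mem (hf m hm)).symm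
  have h2 : (f ∘ₗ (plus ι).subtype) ∘ₗ π' = f ∘ₗ projPlus ι := by
    ext m
    simp [hπ']
  rw [h1, LinearMap.trace_comp_comm', h2, projPlus, LinearMap.comp_smul, LinearMap.comp_add,
    LinearMap.comp_id, map_smul, map_add, smul_eq_mul]

/-! ### The count -/

/-- `s` restricted to `M₊`. [folklore] -/
def sPlus : plus ι →ₗ[ℚ] plus ι := s.restrict fun _ hm ↦ h.s_mem_plus hm

/-- `u` restricted to `M₊`. [folklore] -/
def uPlus : plus ι →ₗ[ℚ] plus ι := u.restrict fun _ hm ↦ h.u_mem_plus hm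

/-- `2 dim (1 + s)M₊ = dim M₊ + trace(s|M₊)`: `(1 + s)/2` is the projection of `M₊` onto its
`s`-invariants. [folklore] -/
theorem two_mul_finrank_map_s :
    2 * (finrank ℚ ((plus ι).map (LinearMap.id + s)) : ℚ) =
      finrank ℚ (plus ι) + LinearMap.trace ℚ (plus ι) h.sPlus := by
  have hP : (LinearMap.id + h.sPlus) ∘ₗ (LinearMap.id + h.sPlus) =
      (2 : ℚ) • (LinearMap.id + h.sPlus) := by
    ext ⟨m, hm⟩
    simp only [sPlus, LinearMap.coe_comp, Function.comp_apply, LinearMap.add_apply,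
      LinearMap.id_apply, map_add, LinearMap.smul_apply, Submodule.coe_add,
      LinearMap.coe_restrict_apply, Submodule.coe_smul_of_tower]
    rw [h.s_s_of_mem hm, two_smul]
    abel
  have htr := ManinCount.trace_eq_mul_finrank_range (LinearMap.id + h.sPlus) two_ne_zero hP
  rw [map_add, LinearMap.trace_id] at htr
  have hr : ((plus ι).map (LinearMap.id + s)) =
      (LinearMap.range (LinearMap.id + h.sPlus)).map (plus ι).subtype := by
    rw [← LinearMap.range_comp]
    have : (plus ι).subtype ∘ₗ (LinearMap.id + h.sPlus) =
        (LinearMap.id + s) ∘ₗ (plus ι).subtype := by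
      ext ⟨m, hm⟩
      simp [sPlus]
    rw [this, LinearMap.range_comp, Submodule.range_subtype]
  rw [hr, Submodule.finrank_map_subtype_eq]
  linarith

/-- `3 dim (1 + u + u²)M₊ = dim M₊ + trace(u|M₊) + trace(u²|M₊)`: `(1 + u + u²)/3` is the
projection of `M₊` onto its `u`-invariants. [folklore] -/
theorem three_mul_finrank_map_u :
    3 * (finrank ℚ ((plus ι).map (LinearMap.id + u + u ∘ₗ u)) : ℚ) =
      finrank ℚ (plus ι) + LinearMap.trace ℚ (plus ι) h.uPlus +
        LinearMap.trace ℚ (plus ι) (h.uPlus ∘ₗ h.uPlus) := by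
  have hP : (LinearMap.id + h.uPlus + h.uPlus ∘ₗ h.uPlus) ∘ₗ
      (LinearMap.id + h.uPlus + h.uPlus ∘ₗ h.uPlus) =
      (3 : ℚ) • (LinearMap.id + h.uPlus + h.uPlus ∘ₗ h.uPlus) := by
    ext ⟨m, hm⟩
    have h3 := h.u_u_u_of_mem hm
    simp only [uPlus, LinearMap.coe_comp, Function.comp_apply, LinearMap.add_apply,
      LinearMap.id_apply, map_add, LinearMap.smul_apply, Submodule.coe_add,
      LinearMap.coe_restrict_apply, Submodule.coe_smul_of_tower]
    rw [h3, (by norm_num : (3 : ℚ) = 2 + 1), add_smul, two_smul, one_smul]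
    abel
  have htr := ManinCount.trace_eq_mul_finrank_range (LinearMap.id + h.uPlus + h.uPlus ∘ₗ h.uPlus)
    three_ne_zero hP
  rw [map_add, map_add, LinearMap.trace_id] at htr
  have hr : ((plus ι).map (LinearMap.id + u + u ∘ₗ u)) =
      (LinearMap.range (LinearMap.id + h.uPlus + h.uPlus ∘ₗ h.uPlus)).map (plus ι).subtype := by
    rw [← LinearMap.range_comp]
    have : (plus ι).subtype ∘ₗ (LinearMap.id + h.uPlus + h.uPlus ∘ₗ h.uPlus) =
        (LinearMap.id + u + u ∘ₗ u) ∘ₗ (plus ι).subtype := by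
      ext ⟨m, hm⟩
      simp [uPlus]
    rw [this, LinearMap.range_comp, Submodule.range_subtype]
  rw [hr, Submodule.finrank_map_subtype_eq]
  linarith

/-- `dim (M/rel) + dim relPlus = dim M₊`. [folklore] -/
theorem finrank_quotient_add :
    finrank ℚ (M ⧸ rel s u ι) + finrank ℚ (relPlus s u ι) = finrank ℚ (plus ι) := by
  have e1 := Submodule.finrank_sup_add_finrank_inf_eq (plus ι)
    (LinearMap.range (LinearMap.id - ι))
  rw [h.plus_sup_range_eq_top, h.plus_inf_range_eq_bot, finrank_top, finrank_bot] at e1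
  have e2 := Submodule.finrank_sup_add_finrank_inf_eq (relPlus s u ι)
    (LinearMap.range (LinearMap.id - ι))
  have hbot : relPlus s u ι ⊓ LinearMap.range (LinearMap.id - ι) = ⊥ := by
    rw [eq_bot_iff, ← h.plus_inf_range_eq_bot]
    exact inf_le_inf_right _ h.relPlus_le_plus
  rw [← h.rel_eq, hbot, finrank_bot] at e2
  have e3 := Submodule.finrank_quotient_add_finrank (rel s u ι)
  omega

/-- **The six-term count**:
`6 dim (M / rel) ≤ dim M₊ - 3 trace(s|M₊) - 2 trace(u|M₊) - 2 trace(u²|M₊) + 6 dim fix`. [folklore] -/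
theorem six_mul_finrank_quotient_le :
    6 * (finrank ℚ (M ⧸ rel s u ι) : ℚ) ≤
      finrank ℚ (plus ι) - 3 * LinearMap.trace ℚ (plus ι) h.sPlus
        - 2 * LinearMap.trace ℚ (plus ι) h.uPlus
        - 2 * LinearMap.trace ℚ (plus ι) (h.uPlus ∘ₗ h.uPlus) + 6 * finrank ℚ (fix s u ι) := by
  have e1 := h.finrank_quotient_add
  have e2 := Submodule.finrank_sup_add_finrank_inf_eq ((plus ι).map (LinearMap.id + s))
    ((plus ι).map (LinearMap.id + u + u ∘ₗ u))
  have e3 : finrank ℚ ↥((plus ι).map (LinearMap.id + s) ⊓ (plus ι).map (LinearMap.id + u + u ∘ₗ u))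
      ≤ finrank ℚ (fix s u ι) := Submodule.finrank_mono h.inf_le_fix
  have e4 := h.two_mul_finrank_map_s
  have e5 := h.three_mul_finrank_map_u
  change finrank ℚ (M ⧸ rel s u ι) + finrank ℚ ↥((plus ι).map (LinearMap.id + s) ⊔
    (plus ι).map (LinearMap.id + u + u ∘ₗ u)) = _ at e1
  have e1' : (finrank ℚ (M ⧸ rel s u ι) : ℚ) + finrank ℚ ↥((plus ι).map (LinearMap.id + s) ⊔
      (plus ι).map (LinearMap.id + u + u ∘ₗ u)) = finrank ℚ (plus ι) := by exact_mod_cast e1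
  have e2' : (finrank ℚ ↥((plus ι).map (LinearMap.id + s) ⊔
      (plus ι).map (LinearMap.id + u + u ∘ₗ u)) : ℚ) +
      finrank ℚ ↥((plus ι).map (LinearMap.id + s) ⊓ (plus ι).map (LinearMap.id + u + u ∘ₗ u)) =
      finrank ℚ ↥((plus ι).map (LinearMap.id + s)) +
        finrank ℚ ↥((plus ι).map (LinearMap.id + u + u ∘ₗ u)) := by exact_mod_cast e2
  have e3' : (finrank ℚ ↥((plus ι).map (LinearMap.id + s) ⊓
      (plus ι).map (LinearMap.id + u + u ∘ₗ u)) : ℚ) ≤ finrank ℚ (fix s u ι) := by exact_mod_cast e3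
  linarith

/-- The restricted traces in ambient form: `trace(s|M₊) = (trace s + trace (s ∘ ι))/2`. [folklore] -/
theorem trace_sPlus : LinearMap.trace ℚ (plus ι) h.sPlus =
    (1 / 2 : ℚ) * (LinearMap.trace ℚ M s + LinearMap.trace ℚ M (s ∘ₗ ι)) :=
  h.trace_restrict_eq s _

/-- `trace(u|M₊) = (trace u + trace (u ∘ ι))/2`. [folklore] -/
theorem trace_uPlus : LinearMap.trace ℚ (plus ι) h.uPlus =
    (1 / 2 : ℚ) * (LinearMap.trace ℚ M u + LinearMap.trace ℚ M (u ∘ₗ ι)) :=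
  h.trace_restrict_eq u _

/-- `trace(u²|M₊) = (trace u² + trace (u² ∘ ι))/2`. [folklore] -/
theorem trace_uPlus_comp : LinearMap.trace ℚ (plus ι) (h.uPlus ∘ₗ h.uPlus) =
    (1 / 2 : ℚ) * (LinearMap.trace ℚ M (u ∘ₗ u) + LinearMap.trace ℚ M ((u ∘ₗ u) ∘ₗ ι)) := by
  have : h.uPlus ∘ₗ h.uPlus = (u ∘ₗ u).restrict
      (fun m hm ↦ h.u_mem_plus (h.u_mem_plus hm) : ∀ m ∈ plus ι, (u ∘ₗ u) m ∈ plus ι) := by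
    ext ⟨m, hm⟩
    simp [uPlus]
  rw [this, h.trace_restrict_eq]

/-- **The six-term count in ambient form**: `12 dim(M/rel) ≤ dim M + tr ι - 3(tr s + tr sι)
- 2(tr u + tr uι) - 2(tr u² + tr u²ι) + 12 dim fix`. [folklore] -/
theorem twelve_mul_finrank_quotient_le :
    12 * (finrank ℚ (M ⧸ rel s u ι) : ℚ) ≤
      finrank ℚ M + LinearMap.trace ℚ M ι
        - 3 * (LinearMap.trace ℚ M s + LinearMap.trace ℚ M (s ∘ₗ ι))
        - 2 * (LinearMap.trace ℚ M u + LinearMap.trace ℚ M (u ∘ₗ ι))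
        - 2 * (LinearMap.trace ℚ M (u ∘ₗ u) + LinearMap.trace ℚ M ((u ∘ₗ u) ∘ₗ ι))
        + 12 * finrank ℚ (fix s u ι) := by
  have e0 := h.six_mul_finrank_quotient_le
  rw [h.trace_sPlus, h.trace_uPlus, h.trace_uPlus_comp] at e0
  have e1 := h.two_mul_finrank_plus
  linarith

end IsSixTerm

end SixTerm

/-! ## A2. Weight-`k` Manin symbols: the module `ℚ[Γ\SL(2,ℤ)] ⊗ V_n` and its count -/

namespace ManinK

open Matrix.SpecialLinearGroup ModularGroup
open scoped MatrixGroups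

/-! ### Homogeneous polynomial functions of degree `d` on `ℤ²` -/

/-- The monomial function `q ↦ q₀ʲ q₁^{d-j}` on `ℤ²` (values in `ℚ`). [folklore] -/
def mono (d j : ℕ) : (Fin 2 → ℤ) → ℚ := fun q ↦ (q 0 : ℚ) ^ j * (q 1 : ℚ) ^ (d - j)

/-- Unfolding `mono`. [folklore] -/
@[simp] theorem mono_apply (d j : ℕ) (q : Fin 2 → ℤ) :
    mono d j q = (q 0 : ℚ) ^ j * (q 1 : ℚ) ^ (d - j) := rfl

/-- `W_d`: the `ℚ`-span of the monomials `q₀ʲ q₁^{d-j}`, `j ≤ d` — the homogeneous polynomial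
functions of degree `d` on `ℤ²`, a model of `Symᵈ` of the standard representation. [folklore] -/
def polyFun (d : ℕ) : Submodule ℚ ((Fin 2 → ℤ) → ℚ) :=
  Submodule.span ℚ (Set.range fun j : Fin (d + 1) ↦ mono d j)

/-- The monomials lie in `W_d`. [folklore] -/
theorem mono_mem {d j : ℕ} (hj : j ≤ d) : mono d j ∈ polyFun d :=
  Submodule.subset_span ⟨⟨j, Nat.lt_succ_of_le hj⟩, rfl⟩

/-- `dim W_d ≤ d + 1`. [folklore] -/
theorem finrank_polyFun_le (d : ℕ) : finrank ℚ (polyFun d) ≤ d + 1 := by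
  have h := finrank_range_le_card (R := ℚ) (fun j : Fin (d + 1) ↦ mono d j)
  rw [Fintype.card_fin] at h
  exact h

/-- `W_d` is finite-dimensional. [folklore] -/
instance (d : ℕ) : FiniteDimensional ℚ (polyFun d) :=
  Module.Finite.span_of_finite ℚ (Set.finite_range _)

/-- Multiplication by an integer linear form maps `W_d` into `W_{d+1}`. [folklore] -/
theorem mul_linear_mem {d : ℕ} {φ : (Fin 2 → ℤ) → ℚ} (hφ : φ ∈ polyFun d) (a b : ℤ) :
    (fun q ↦ φ q * ((a : ℚ) * q 0 + (b : ℚ) * q 1)) ∈ polyFun (d + 1) := by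
  induction hφ using Submodule.span_induction with
  | mem x hx =>
    obtain ⟨⟨j, hj⟩, rfl⟩ := hx
    have heq : (fun q ↦ mono d j q * ((a : ℚ) * q 0 + (b : ℚ) * q 1)) =
        (a : ℚ) • mono (d + 1) (j + 1) + (b : ℚ) • mono (d + 1) j := by
      funext q
      simp only [mono_apply, Pi.add_apply, Pi.smul_apply, smul_eq_mul]
      have h1 : d + 1 - (j + 1) = d - j := by omega
      have h2 : d + 1 - j = (d - j) + 1 := by omega
      rw [h1, h2, pow_succ, pow_succ]
      ring
    rw [heq]
    exact add_mem (Submodule.smul_mem _ _ (mono_mem (by omega)))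
      (Submodule.smul_mem _ _ (mono_mem (by omega)))
  | zero =>
    have heq : (fun q ↦ (0 : (Fin 2 → ℤ) → ℚ) q * ((a : ℚ) * q 0 + (b : ℚ) * q 1)) = 0 := by
      funext q; simp
    rw [heq]
    exact zero_mem _
  | add x y _ _ hx hy =>
    have heq : (fun q ↦ (x + y) q * ((a : ℚ) * q 0 + (b : ℚ) * q 1)) =
        (fun q ↦ x q * ((a : ℚ) * q 0 + (b : ℚ) * q 1)) +
          fun q ↦ y q * ((a : ℚ) * q 0 + (b : ℚ) * q 1) := by
      funext q; simp [add_mul]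
    rw [heq]
    exact add_mem hx hy
  | smul c x _ hx =>
    have heq : (fun q ↦ (c • x) q * ((a : ℚ) * q 0 + (b : ℚ) * q 1)) =
        c • fun q ↦ x q * ((a : ℚ) * q 0 + (b : ℚ) * q 1) := by
      funext q; simp [mul_assoc]
    rw [heq]
    exact Submodule.smul_mem _ _ hx

/-- Powers of an integer linear form: `(a q₀ + b q₁)ʲ ∈ W_j`. [folklore] -/
theorem linear_pow_mem (a b : ℤ) (j : ℕ) :
    (fun q : Fin 2 → ℤ ↦ ((a : ℚ) * q 0 + (b : ℚ) * q 1) ^ j) ∈ polyFun j := by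
  induction j with
  | zero =>
    have : (fun q : Fin 2 → ℤ ↦ ((a : ℚ) * q 0 + (b : ℚ) * q 1) ^ 0) = mono 0 0 := by
      funext q; simp
    rw [this]
    exact mono_mem le_rfl
  | succ j ih =>
    have := mul_linear_mem ih a b
    simpa only [pow_succ] using this

/-- Products of powers of two integer linear forms of total degree `d` lie in `W_d`. [folklore] -/
theorem pow_mul_pow_mem (a b c e : ℤ) {i j d : ℕ} (hd : i + j = d) :
    (fun q : Fin 2 → ℤ ↦ ((a : ℚ) * q 0 + (b : ℚ) * q 1) ^ i * ((c : ℚ) * q 0 + (e : ℚ) * q 1) ^ j) ∈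
      polyFun d := by
  subst hd
  induction i with
  | zero => simpa using linear_pow_mem c e j
  | succ i ih =>
    have := mul_linear_mem ih a b
    have heq : (fun q : Fin 2 → ℤ ↦
        ((a : ℚ) * q 0 + (b : ℚ) * q 1) ^ (i + 1) * ((c : ℚ) * q 0 + (e : ℚ) * q 1) ^ j) =
        fun q ↦ ((a : ℚ) * q 0 + (b : ℚ) * q 1) ^ i * ((c : ℚ) * q 0 + (e : ℚ) * q 1) ^ j *
          ((a : ℚ) * q 0 + (b : ℚ) * q 1) := by
      funext q; ring
    rw [heq, show i + 1 + j = i + j + 1 by omega]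
    exact this

/-! ### The action of `SL(2, ℤ)` on `ℤ²`, on functions, and on `V_n = W_n^*` -/

/-- The standard action of `SL(2, ℤ)` on integer column vectors. [folklore] -/
def act (g : SL(2, ℤ)) (q : Fin 2 → ℤ) : Fin 2 → ℤ := (g : Matrix (Fin 2) (Fin 2) ℤ).mulVec q

/-- First coordinate of `g q`. [folklore] -/
theorem act_apply_zero (g : SL(2, ℤ)) (q : Fin 2 → ℤ) : act g q 0 = g 0 0 * q 0 + g 0 1 * q 1 := by
  simp [act, Matrix.mulVec, dotProduct, Fin.sum_univ_two]

/-- Second coordinate of `g q`. [folklore] -/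
theorem act_apply_one (g : SL(2, ℤ)) (q : Fin 2 → ℤ) : act g q 1 = g 1 0 * q 0 + g 1 1 * q 1 := by
  simp [act, Matrix.mulVec, dotProduct, Fin.sum_univ_two]

/-- `(gh) q = g (h q)`. [folklore] -/
theorem act_mul (g h : SL(2, ℤ)) (q : Fin 2 → ℤ) : act (g * h) q = act g (act h q) := by
  unfold act
  rw [Matrix.SpecialLinearGroup.coe_mul, Matrix.mulVec_mulVec]

/-- `1 q = q`. [folklore] -/
@[simp] theorem act_one (q : Fin 2 → ℤ) : act 1 q = q := by simp [act]

/-- `(-g) q = -(g q)`. [folklore] -/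
theorem act_neg (g : SL(2, ℤ)) (q : Fin 2 → ℤ) : act (-g) q = -act g q := by
  simp [act, Matrix.neg_mulVec]

/-- `g⁻¹ (g q) = q`. [folklore] -/
theorem act_inv_act (g : SL(2, ℤ)) (q : Fin 2 → ℤ) : act g⁻¹ (act g q) = q := by
  rw [← act_mul, inv_mul_cancel, act_one]

/-- `g (g⁻¹ q) = q`. [folklore] -/
theorem act_act_inv (g : SL(2, ℤ)) (q : Fin 2 → ℤ) : act g (act g⁻¹ q) = q := by
  rw [← act_mul, mul_inv_cancel, act_one]

/-- Precomposition with the action: `(g^* φ)(q) = φ(g q)`. [folklore] -/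
def precomp (g : SL(2, ℤ)) : ((Fin 2 → ℤ) → ℚ) →ₗ[ℚ] ((Fin 2 → ℤ) → ℚ) :=
  LinearMap.funLeft ℚ ℚ (act g)

/-- Unfolding `precomp`. [folklore] -/
@[simp] theorem precomp_apply (g : SL(2, ℤ)) (φ : (Fin 2 → ℤ) → ℚ) (q : Fin 2 → ℤ) :
    precomp g φ q = φ (act g q) := rfl

/-- Precomposition is contravariant. [folklore] -/
theorem precomp_mul (g h : SL(2, ℤ)) : precomp (g * h) = precomp h ∘ₗ precomp g := by
  ext φ q
  simp [act_mul]

/-- `W_n` is stable under precomposition. [folklore] -/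
theorem precomp_mem (n : ℕ) (g : SL(2, ℤ)) {φ : (Fin 2 → ℤ) → ℚ} (hφ : φ ∈ polyFun n) :
    precomp g φ ∈ polyFun n := by
  induction hφ using Submodule.span_induction with
  | mem x hx =>
    obtain ⟨⟨j, hj⟩, rfl⟩ := hx
    have heq : precomp g (mono n j) = fun q ↦
        (((g 0 0 : ℤ) : ℚ) * q 0 + ((g 0 1 : ℤ) : ℚ) * q 1) ^ j *
          (((g 1 0 : ℤ) : ℚ) * q 0 + ((g 1 1 : ℤ) : ℚ) * q 1) ^ (n - j) := by
      funext q
      simp [act_apply_zero, act_apply_one]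
    rw [heq]
    exact pow_mul_pow_mem _ _ _ _ (by omega)
  | zero => rw [map_zero]; exact zero_mem _
  | add x y _ _ hx hy => rw [map_add]; exact add_mem hx hy
  | smul c x _ hx => rw [map_smul]; exact Submodule.smul_mem _ _ hx

variable (n : ℕ)

/-- Precomposition restricted to `W_n`. [folklore] -/
def precompW (g : SL(2, ℤ)) : polyFun n →ₗ[ℚ] polyFun n :=
  (precomp g).restrict fun _ hφ ↦ precomp_mem n g hφ

/-- Unfolding `precompW`. [folklore] -/
@[simp] theorem coe_precompW (g : SL(2, ℤ)) (w : polyFun n) :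
    ((precompW n g w : polyFun n) : (Fin 2 → ℤ) → ℚ) = precomp g w := rfl

/-- `precompW` is contravariant. [folklore] -/
theorem precompW_mul (g h : SL(2, ℤ)) : precompW n (g * h) = precompW n h ∘ₗ precompW n g := by
  ext w q
  simp [act_mul]

/-- `precompW 1 = 1`. [folklore] -/
theorem precompW_one : precompW n 1 = LinearMap.id := by
  ext w q
  simp

/-- `V_n = W_n^*`, the coefficient module of the weight-`(n+2)` Manin symbols. [folklore] -/
abbrev V : Type := Module.Dual ℚ (polyFun n)

/-- The (covariant) action of `SL(2, ℤ)` on `V_n`: the transpose of precomposition,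
`ρ(g) ev_q = ev_{gq}`. [folklore] -/
def rho (g : SL(2, ℤ)) : V n →ₗ[ℚ] V n := (precompW n g).dualMap

/-- Unfolding `ρ`. [folklore] -/
theorem rho_apply (g : SL(2, ℤ)) (v : V n) (w : polyFun n) : rho n g v w = v (precompW n g w) := rfl

/-- `ρ` is a representation: `ρ(gh) = ρ(g)ρ(h)`. [folklore] -/
theorem rho_mul (g h : SL(2, ℤ)) : rho n (g * h) = rho n g ∘ₗ rho n h := by
  rw [rho, precompW_mul, ← LinearMap.dualMap_comp_dualMap]
  rfl

/-- `ρ(1) = 1`. [folklore] -/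
theorem rho_one : rho n 1 = LinearMap.id := by
  rw [rho, precompW_one]
  rfl

/-- `ρ(g⁻¹)ρ(g) = 1` pointwise. [folklore] -/
theorem rho_inv_rho (g : SL(2, ℤ)) (v : V n) : rho n g⁻¹ (rho n g v) = v := by
  rw [← LinearMap.comp_apply, ← rho_mul, inv_mul_cancel, rho_one, LinearMap.id_apply]

/-- `ρ(g)ρ(g⁻¹) = 1` pointwise. [folklore] -/
theorem rho_rho_inv (g : SL(2, ℤ)) (v : V n) : rho n g (rho n g⁻¹ v) = v := by
  rw [← LinearMap.comp_apply, ← rho_mul, mul_inv_cancel, rho_one, LinearMap.id_apply]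

/-- The evaluation functionals `ev_q ∈ V_n`, `q ∈ ℤ²`. [folklore] -/
def ev (q : Fin 2 → ℤ) : V n := (LinearMap.proj q).comp (polyFun n).subtype

/-- Unfolding `ev`. [folklore] -/
@[simp] theorem ev_apply (q : Fin 2 → ℤ) (w : polyFun n) : ev n q w = (w : (Fin 2 → ℤ) → ℚ) q := rfl

/-- `ρ(g) ev_q = ev_{gq}`. [folklore] -/
@[simp] theorem rho_ev (g : SL(2, ℤ)) (q : Fin 2 → ℤ) : rho n g (ev n q) = ev n (act g q) := rfl

/-- **The evaluations span `V_n`** (`W_n` is finite-dimensional and its elements are functions,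
separated by their values). [folklore] -/
theorem span_ev : Submodule.span ℚ (Set.range (ev n)) = ⊤ := by
  by_contra htop
  obtain ⟨φ, hφ, hker⟩ := Submodule.exists_le_ker_of_lt_top _ (lt_top_iff_ne_top.mpr htop)
  obtain ⟨w, rfl⟩ := (Module.evalEquiv ℚ (polyFun n)).surjective φ
  have hw : ∀ q, (w : (Fin 2 → ℤ) → ℚ) q = 0 := fun q ↦ by
    have := hker (Submodule.subset_span ⟨q, rfl⟩)
    simpa using this
  apply hφ
  have : w = 0 := by
    ext q
    exact hw q
  rw [this, map_zero]

/-- The monomials as elements of `W_n` (`0` for `j > n`). [folklore] -/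
def monoW (j : ℕ) : polyFun n := if h : j ≤ n then ⟨mono n j, mono_mem h⟩ else 0

/-- Unfolding `monoW` for `j ≤ n`. [folklore] -/
theorem coe_monoW {j : ℕ} (hj : j ≤ n) : ((monoW n j : polyFun n) : (Fin 2 → ℤ) → ℚ) = mono n j := by
  simp [monoW, hj]

/-- `ev_q` on the monomials. [folklore] -/
theorem ev_monoW {j : ℕ} (hj : j ≤ n) (q : Fin 2 → ℤ) : ev n q (monoW n j) = mono n j q := by
  rw [ev_apply, coe_monoW n hj]


/-! ### Translates of monomials by unipotent elements -/

/-- `T^w`-translate of a monomial: `(q₀ + w q₁)ʲ q₁^{n-j} = ∑_{i ≤ j} C(j,i) w^{j-i} q₀ⁱ q₁^{n-i}`.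
[folklore] -/
theorem precompW_T_zpow_monoW (w : ℤ) {j : ℕ} (hj : j ≤ n) :
    precompW n (T ^ w) (monoW n j) =
      ∑ i ∈ Finset.range (j + 1), ((j.choose i : ℚ) * (w : ℚ) ^ (j - i)) • monoW n i := by
  apply Subtype.ext
  rw [coe_precompW, Submodule.coe_sum]
  funext q
  rw [Finset.sum_apply, precomp_apply, coe_monoW n hj, mono_apply, act_apply_zero, act_apply_one]
  simp only [ModularGroup.coe_T_zpow, Matrix.of_apply, Matrix.cons_val', Matrix.cons_val_zero,
    Matrix.cons_val_one, Matrix.cons_val_fin_one, Matrix.empty_val', one_mul, zero_mul, zero_add]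
  push_cast
  rw [add_pow, Finset.sum_mul]
  refine Finset.sum_congr rfl fun i hi ↦ ?_
  have hij : i ≤ j := Nat.lt_succ_iff.mp (Finset.mem_range.mp hi)
  rw [Pi.smul_apply, coe_monoW n (hij.trans hj), mono_apply, smul_eq_mul]
  have : n - i = (j - i) + (n - j) := by omega
  rw [this, pow_add, mul_pow]
  ring

/-- The lower unipotent `S⁻¹ Tʷ S = (1 0; -w 1)` on the second-highest monomial:
`q₀^{n-1}(q₁ - w q₀) = -w q₀ⁿ + q₀^{n-1} q₁`. [folklore] -/
theorem precompW_lower_monoW (hn : 1 ≤ n) (w : ℤ) :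
    precompW n (S⁻¹ * T ^ w * S) (monoW n (n - 1)) = (-(w : ℚ)) • monoW n n + monoW n (n - 1) := by
  apply Subtype.ext
  rw [coe_precompW, Submodule.coe_add, Submodule.coe_smul]
  funext q
  rw [precomp_apply, coe_monoW n (Nat.sub_le n 1), Pi.add_apply, Pi.smul_apply,
    coe_monoW n le_rfl, mono_apply, mono_apply, mono_apply, act_mul, act_mul, act_apply_zero,
    act_apply_one]
  simp only [act_apply_zero, act_apply_one, ModularGroup.S_inv, ModularGroup.coe_T_zpow,
    Matrix.SpecialLinearGroup.coe_neg, ModularGroup.coe_S, Matrix.neg_apply, Matrix.of_apply,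
    Matrix.cons_val', Matrix.cons_val_zero, Matrix.cons_val_one, Matrix.cons_val_fin_one,
    Matrix.empty_val', one_mul, zero_mul, zero_add, add_zero, neg_zero, smul_eq_mul]
  have h1 : n - (n - 1) = 1 := by omega
  rw [h1, Nat.sub_self, pow_zero, pow_one, mul_one]
  obtain ⟨m, rfl⟩ : ∃ m, n = m + 1 := ⟨n - 1, by omega⟩
  rw [Nat.add_sub_cancel, pow_succ]
  push_cast
  ring

/-- **No invariant functionals** (`n ≥ 1`): a functional on `W_n` fixed by (the transposes of)
`T^w` and `S⁻¹ T^{w'} S` with `w, w' ≠ 0` vanishes — `V_n^Γ = 0` for every finite-index `Γ`.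
The `T^w`-invariance gives the triangular system `∑_{i<j} C(j,i) w^{j-i} λ(q₀ⁱq₁^{n-i}) = 0`
(`j ≤ n`), whence `λ = 0` on the monomials with `i < n`; the lower unipotent then kills `λ(q₀ⁿ)`.
[folklore] -/
theorem dual_eq_zero_of_invariant (hn : 1 ≤ n) {w w' : ℤ} (hw : w ≠ 0) (hw' : w' ≠ 0) (v : V n)
    (hT : rho n (T ^ w) v = v) (hL : rho n (S⁻¹ * T ^ w' * S) v = v) : v = 0 := by
  have hrec : ∀ j, j ≤ n →
      ∑ i ∈ Finset.range j, ((j.choose i : ℚ) * (w : ℚ) ^ (j - i)) * v (monoW n i) = 0 := by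
    intro j hj
    have h1 := LinearMap.congr_fun hT (monoW n j)
    rw [rho_apply, precompW_T_zpow_monoW n w hj, map_sum, Finset.sum_range_succ] at h1
    simp only [map_smul, smul_eq_mul, Nat.choose_self, Nat.sub_self, pow_zero, Nat.cast_one,
      mul_one, one_mul] at h1
    linarith
  have hlow : ∀ i, i < n → v (monoW n i) = 0 := by
    intro i
    induction i using Nat.strong_induction_on with
    | _ i ih =>
      intro hi
      have h := hrec (i + 1) hi
      rw [Finset.sum_range_succ, Finset.sum_eq_zero (fun i' hi' ↦ by
        rw [ih i' (Finset.mem_range.mp hi') ((Finset.mem_range.mp hi').trans hi), mul_zero]),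
        zero_add, Nat.choose_succ_self_right, show i + 1 - i = 1 by omega, pow_one] at h
      have hne : ((i + 1 : ℕ) : ℚ) * (w : ℚ) ≠ 0 :=
        mul_ne_zero (by exact_mod_cast Nat.succ_ne_zero i) (by exact_mod_cast hw)
      exact (mul_eq_zero.mp h).resolve_left hne
  have htop : v (monoW n n) = 0 := by
    have h1 := LinearMap.congr_fun hL (monoW n (n - 1))
    rw [rho_apply, precompW_lower_monoW n hn w', map_add, map_smul, smul_eq_mul] at h1
    have h2 : (w' : ℚ) * v (monoW n n) = 0 := by linarith
    exact (mul_eq_zero.mp h2).resolve_left (by exact_mod_cast hw')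
  have hall : ∀ j, j ≤ n → v (monoW n j) = 0 := fun j hj ↦ by
    rcases hj.lt_or_eq with h | rfl
    · exact hlow j h
    · exact htop
  refine LinearMap.ext fun ⟨x, hx⟩ ↦ ?_
  rw [LinearMap.zero_apply]
  induction hx using Submodule.span_induction with
  | mem x hx' =>
    obtain ⟨⟨j, hj⟩, rfl⟩ := hx'
    have := hall j (by omega)
    rwa [monoW, dif_pos (by omega)] at this
  | zero => exact v.map_zero
  | add x y hx hy hx' hy' =>
    have : (⟨x + y, Submodule.add_mem _ hx hy⟩ : polyFun n) = ⟨x, hx⟩ + ⟨y, hy⟩ := rfl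
    rw [this, map_add, hx', hy', add_zero]
  | smul c x hx hx' =>
    have : (⟨c • x, Submodule.smul_mem _ c hx⟩ : polyFun n) = c • ⟨x, hx⟩ := rfl
    rw [this, map_smul, hx', smul_zero]

/-! ### The Manin module `M = (SL(2, ℤ)/Γ → V_n)` and the operators of `S`, `TS`, `-1` -/

variable (Γ : Subgroup SL(2, ℤ))

/-- The cosets `gΓ` (the coset `gΓ` stands for the Manin symbols `[g⁻¹, ·]` of the right coset
`Γg⁻¹`). [folklore] -/
abbrev Coset : Type := SL(2, ℤ) ⧸ Γ

/-- The coset space of a finite-index subgroup is a finite type (noncomputably). [folklore] -/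
instance [Γ.FiniteIndex] : Fintype (Coset Γ) := Fintype.ofFinite _

/-- The module `M = ℚ[SL(2, ℤ)/Γ] ⊗ V_n` of formal weight-`(n + 2)` Manin symbols, as functions
`SL(2, ℤ)/Γ → V_n`. [folklore] -/
abbrev MM : Type := Coset Γ → V n

/-- The operator of `g ∈ SL(2, ℤ)` on `M`: `(g^* F)(x) = ρ(g⁻¹) F(g x)`. [folklore] -/
def gOp (g : SL(2, ℤ)) : MM n Γ →ₗ[ℚ] MM n Γ :=
  (rho n g⁻¹).compLeft (Coset Γ) ∘ₗ LinearMap.funLeft ℚ (V n) (fun x : Coset Γ ↦ g • x)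

/-- Unfolding `g^*`. [folklore] -/
@[simp] theorem gOp_apply (g : SL(2, ℤ)) (F : MM n Γ) (x : Coset Γ) :
    gOp n Γ g F x = rho n g⁻¹ (F (g • x)) := rfl

/-- `(gh)^* = h^* ∘ g^*`. [folklore] -/
theorem gOp_mul (g h : SL(2, ℤ)) : gOp n Γ (g * h) = gOp n Γ h ∘ₗ gOp n Γ g := by
  apply LinearMap.ext
  intro F
  funext x
  simp only [gOp_apply, LinearMap.comp_apply, mul_inv_rev, rho_mul, mul_smul]

/-- `1^* = 1`. [folklore] -/
theorem gOp_one : gOp n Γ 1 = LinearMap.id := by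
  apply LinearMap.ext
  intro F
  funext x
  simp [rho_one]

/-- The operator of `S`. [folklore] -/
def sOp : MM n Γ →ₗ[ℚ] MM n Γ := gOp n Γ S

/-- The operator of `TS` (of order `6`, `(TS)³ = -1`). [folklore] -/
def uOp : MM n Γ →ₗ[ℚ] MM n Γ := gOp n Γ (T * S)

/-- The operator of `-1`. [folklore] -/
def iOp : MM n Γ →ₗ[ℚ] MM n Γ := gOp n Γ (-1)

/-- `S² = (TS)³ = -1`, `(-1)² = 1` on `M`. [folklore] -/
theorem isSixTerm : SixTerm.IsSixTerm (sOp n Γ) (uOp n Γ) (iOp n Γ) where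
  iota_comp := by rw [iOp, ← gOp_mul, neg_mul_neg, one_mul, gOp_one]
  s_comp := by rw [sOp, iOp, ← gOp_mul, S_mul_S_eq_neg_one]
  u_comp := by rw [uOp, iOp, ← gOp_mul, ← gOp_mul, TS_pow_three_eq]

/-- The relation module of the weight-`(n + 2)` Manin symbols of `Γ`: two-term, three-term and
sign relations. [folklore] -/
abbrev relK : Submodule ℚ (MM n Γ) := SixTerm.rel (sOp n Γ) (uOp n Γ) (iOp n Γ)

/-- **The trace of `g^*` vanishes when `g` has no fixed coset** (block permutation matrix with
zero diagonal blocks, in the basis `e_x ⊗ v_k`). [folklore] -/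
theorem trace_gOp_eq_zero [Γ.FiniteIndex] (g : SL(2, ℤ)) (hg : ∀ x : Coset Γ, g • x ≠ x) :
    LinearMap.trace ℚ (MM n Γ) (gOp n Γ g) = 0 := by
  classical
  let bV := Module.finBasis ℚ (V n)
  let b := Pi.basis fun _ : Coset Γ ↦ bV
  rw [LinearMap.trace_eq_matrix_trace ℚ b]
  refine Finset.sum_eq_zero fun ji _ ↦ ?_
  rw [Matrix.diag_apply, LinearMap.toMatrix_apply, Pi.basis_repr, Pi.basis_apply, gOp_apply]
  have : (Pi.single ji.1 (bV ji.2) : MM n Γ) (g • ji.1) = 0 := Pi.single_eq_of_ne (hg ji.1) _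
  rw [this, map_zero, map_zero, Finsupp.zero_apply]

/-- **The invariants vanish** (`n ≥ 1`): `M₊^{S, TS} = 0`, since a vector fixed by `S^*`, `(TS)^*`
and `(-1)^*` is fixed by every `g^*` (`SL(2, ℤ) = ⟨S, T⟩`), so `F(gx) = ρ(g)F(x)` and `F(Γ) ∈ V_n^Γ`,
which is `0` (`dual_eq_zero_of_invariant` with powers `T^w, (S⁻¹TS)^{w'} ∈ Γ`, `Γ` of finite
index). [folklore] -/
theorem fix_eq_bot [Γ.FiniteIndex] (hn : 1 ≤ n) :
    SixTerm.fix (sOp n Γ) (uOp n Γ) (iOp n Γ) = ⊥ := by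
  rw [eq_bot_iff]
  intro F hF
  obtain ⟨-, hs, hu⟩ := SixTerm.mem_fix.mp hF
  let K : Subgroup SL(2, ℤ) :=
    { carrier := {g | gOp n Γ g F = F}
      mul_mem' := fun {a b} ha hb ↦ by
        change gOp n Γ (a * b) F = F
        change gOp n Γ a F = F at ha
        change gOp n Γ b F = F at hb
        rw [gOp_mul, LinearMap.comp_apply, ha, hb]
      one_mem' := by
        change gOp n Γ 1 F = F
        rw [gOp_one, LinearMap.id_apply]
      inv_mem' := fun {a} ha ↦ by
        change gOp n Γ a⁻¹ F = F
        change gOp n Γ a F = F at ha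
        have := LinearMap.congr_fun (gOp_mul n Γ a a⁻¹) F
        rw [mul_inv_cancel, gOp_one, LinearMap.id_apply, LinearMap.comp_apply, ha] at this
        exact this.symm }
  have hSK : S ∈ K := hs
  have hTSK : T * S ∈ K := hu
  have hTK : T ∈ K := by
    have : T = T * S * S⁻¹ := by group
    rw [this]
    exact K.mul_mem hTSK (K.inv_mem hSK)
  have hK : K = ⊤ := by
    rw [eq_top_iff, ← SpecialLinearGroup.SL2Z_generators, Subgroup.closure_le]
    rintro g (rfl | rfl)
    · exact hSK
    · exact hTK
  have hall : ∀ g : SL(2, ℤ), gOp n Γ g F = F := fun g ↦ (hK ▸ Subgroup.mem_top g : g ∈ K)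
  have hcov : ∀ (g : SL(2, ℤ)) (x : Coset Γ), F (g • x) = rho n g (F x) := fun g x ↦ by
    have := congr_fun (hall g) x
    rw [gOp_apply] at this
    rw [← this, rho_rho_inv]
  set x₀ : Coset Γ := ((1 : SL(2, ℤ)) : Coset Γ) with hx₀
  have hΓ : ∀ γ ∈ Γ, rho n γ (F x₀) = F x₀ := fun γ hγ ↦ by
    rw [← hcov]
    congr 1
    rw [hx₀, MulAction.Quotient.smul_mk, smul_eq_mul, mul_one, QuotientGroup.eq, mul_one]
    exact Γ.inv_mem hγ
  obtain ⟨w, hw0, -, hw⟩ := Γ.exists_pow_mem_of_index_ne_zero Subgroup.FiniteIndex.index_ne_zero T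
  obtain ⟨w', hw0', -, hw'⟩ :=
    Γ.exists_pow_mem_of_index_ne_zero Subgroup.FiniteIndex.index_ne_zero (S⁻¹ * T * S)
  have hL : (S⁻¹ * T * S) ^ w' = S⁻¹ * T ^ (w' : ℤ) * S := by
    rw [zpow_natCast]
    have := @conj_pow _ _ w' S⁻¹ T
    rwa [inv_inv] at this
  rw [← zpow_natCast] at hw
  rw [hL] at hw'
  have h0 : F x₀ = 0 :=
    dual_eq_zero_of_invariant n hn (w := w) (w' := w') (by exact_mod_cast hw0.ne')
      (by exact_mod_cast hw0'.ne') (F x₀) (hΓ _ hw) (hΓ _ hw')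
  rw [Submodule.mem_bot]
  funext x
  induction x using QuotientGroup.induction_on with
  | H g =>
    have : ((g : SL(2, ℤ)) : Coset Γ) = g • x₀ := by
      rw [hx₀, MulAction.Quotient.smul_mk, smul_eq_mul, mul_one]
    rw [this, hcov, h0, map_zero]
    rfl

/-! ### Polynomial symbol systems: maps out of `M / rel` -/

variable {E : Type*} [AddCommGroup E] [Module ℚ E]

/-- A **system of weight-`(n + 2)` Manin symbols** of `Γ` with values in a `ℚ`-module `E`: for each
coset `x = gΓ` a function `q ↦ [x, q] ∈ E` of `q ∈ ℤ²` which is a homogeneous polynomial of degree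
`n` in `q` and satisfies the two-term, three-term and sign relations of Manin symbols
(for periods: `[gΓ, q] = ∫_{g⁻¹0}^{g⁻¹∞} f(z)((g⁻¹q)₁z - (g⁻¹q)₀)ⁿ dz`). [folklore] -/
structure PolySymbol (n : ℕ) (Γ : Subgroup SL(2, ℤ)) (E : Type*) [AddCommGroup E] [Module ℚ E] where
  /-- The symbols. -/
  toFun : Coset Γ → (Fin 2 → ℤ) → E
  /-- Polynomiality in `q`. -/
  poly : ∀ x, ∃ μ : ℕ → E, ∀ q, toFun x q = ∑ j ∈ Finset.range (n + 1), mono n j q • μ j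
  /-- The two-term relation `[x, q] + [S⁻¹x, S⁻¹q] = 0`. -/
  two_term : ∀ x q, toFun x q + toFun (S⁻¹ • x) (act S⁻¹ q) = 0
  /-- The three-term relation for `U = TS`. -/
  three_term : ∀ x q, toFun x q + toFun ((T * S)⁻¹ • x) (act (T * S)⁻¹ q) +
    toFun ((T * S)⁻¹ • (T * S)⁻¹ • x) (act (T * S)⁻¹ (act (T * S)⁻¹ q)) = 0
  /-- The sign relation `[-x, -q] = [x, q]`. -/
  neg : ∀ x q, toFun ((-1 : SL(2, ℤ)) • x) (-q) = toFun x q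

namespace PolySymbol

variable {n Γ}
variable (P : PolySymbol n Γ E)

/-- The linear extension `Sym_x : V_n → E` of `ev_q ↦ [x, q]`. [folklore] -/
def sym (x : Coset Γ) : V n →ₗ[ℚ] E :=
  ∑ j ∈ Finset.range (n + 1), (LinearMap.applyₗ (monoW n j)).smulRight ((P.poly x).choose j)

/-- Unfolding `Sym_x`. [folklore] -/
theorem sym_apply (x : Coset Γ) (v : V n) :
    P.sym x v = ∑ j ∈ Finset.range (n + 1), v (monoW n j) • (P.poly x).choose j := by
  simp [sym]

/-- `Sym_x(ev_q) = [x, q]`. [folklore] -/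
@[simp] theorem sym_ev (x : Coset Γ) (q : Fin 2 → ℤ) : P.sym x (ev n q) = P.toFun x q := by
  rw [(P.poly x).choose_spec q, sym_apply]
  refine Finset.sum_congr rfl fun j hj ↦ ?_
  rw [ev_monoW n (Nat.lt_succ_iff.mp (Finset.mem_range.mp hj))]

/-- The two-term relation on all of `V_n` (the evaluations span). [folklore] -/
theorem sym_two_term (x : Coset Γ) (v : V n) : P.sym x v + P.sym (S⁻¹ • x) (rho n S⁻¹ v) = 0 := by
  have : P.sym x + P.sym (S⁻¹ • x) ∘ₗ rho n S⁻¹ = 0 := by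
    refine LinearMap.ext_on_range (span_ev n) fun q ↦ ?_
    simp [P.two_term]
  exact LinearMap.congr_fun this v

/-- The three-term relation on all of `V_n`. [folklore] -/
theorem sym_three_term (x : Coset Γ) (v : V n) :
    P.sym x v + P.sym ((T * S)⁻¹ • x) (rho n (T * S)⁻¹ v) +
      P.sym ((T * S)⁻¹ • (T * S)⁻¹ • x) (rho n (T * S)⁻¹ (rho n (T * S)⁻¹ v)) = 0 := by
  have : P.sym x + P.sym ((T * S)⁻¹ • x) ∘ₗ rho n (T * S)⁻¹ +
      P.sym ((T * S)⁻¹ • (T * S)⁻¹ • x) ∘ₗ rho n (T * S)⁻¹ ∘ₗ rho n (T * S)⁻¹ = 0 := by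
    refine LinearMap.ext_on_range (span_ev n) fun q ↦ ?_
    simp only [LinearMap.add_apply, LinearMap.comp_apply, rho_ev, sym_ev, LinearMap.zero_apply]
    exact P.three_term x q
  exact LinearMap.congr_fun this v

/-- The sign relation on all of `V_n`. [folklore] -/
theorem sym_neg (x : Coset Γ) (v : V n) : P.sym ((-1 : SL(2, ℤ)) • x) (rho n (-1) v) = P.sym x v := by
  have : P.sym ((-1 : SL(2, ℤ)) • x) ∘ₗ rho n (-1) = P.sym x := by
    refine LinearMap.ext_on_range (span_ev n) fun q ↦ ?_
    simp [act_neg, P.neg]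
  exact LinearMap.congr_fun this v

variable [Γ.FiniteIndex]

/-- The total map `Ψ : M → E`, `F ↦ ∑_x Sym_x(F(x))`. [folklore] -/
def total : MM n Γ →ₗ[ℚ] E := ∑ x : Coset Γ, P.sym x ∘ₗ LinearMap.proj x

/-- Unfolding `Ψ`. [folklore] -/
theorem total_apply (F : MM n Γ) : P.total F = ∑ x, P.sym x (F x) := by
  simp [total]

/-- `Ψ(g^* F) = ∑_x Sym_{g⁻¹x}(ρ(g⁻¹)F(x))` (reindexing). [folklore] -/
theorem total_gOp (g : SL(2, ℤ)) (F : MM n Γ) :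
    P.total (gOp n Γ g F) = ∑ x, P.sym (g⁻¹ • x) (rho n g⁻¹ (F x)) := by
  rw [total_apply]
  exact Fintype.sum_equiv (MulAction.toPerm g) _ _ fun x ↦ by simp [inv_smul_smul]

/-- `Ψ ∘ S^* = -Ψ`. [folklore] -/
theorem total_sOp (F : MM n Γ) : P.total (sOp n Γ F) = -P.total F := by
  rw [sOp, total_gOp, total_apply, eq_neg_iff_add_eq_zero, ← Finset.sum_add_distrib]
  exact Finset.sum_eq_zero fun x _ ↦ by rw [add_comm]; exact P.sym_two_term x (F x)

/-- `Ψ (1 + U^* + U^{*2}) = 0`. [folklore] -/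
theorem total_uOp (F : MM n Γ) :
    P.total F + P.total (uOp n Γ F) + P.total (uOp n Γ (uOp n Γ F)) = 0 := by
  have h2 : uOp n Γ (uOp n Γ F) = gOp n Γ (T * S * (T * S)) F := by
    rw [gOp_mul, LinearMap.comp_apply, uOp]
  have h3 : P.total (gOp n Γ (T * S * (T * S)) F) =
      ∑ x, P.sym ((T * S)⁻¹ • (T * S)⁻¹ • x) (rho n (T * S)⁻¹ (rho n (T * S)⁻¹ (F x))) := by
    rw [total_gOp]
    refine Finset.sum_congr rfl fun x _ ↦ ?_
    rw [mul_inv_rev, mul_smul, rho_mul, LinearMap.comp_apply]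
  rw [h2, h3, uOp, total_gOp, total_apply, ← Finset.sum_add_distrib, ← Finset.sum_add_distrib]
  exact Finset.sum_eq_zero fun x _ ↦ P.sym_three_term x (F x)

/-- `Ψ ∘ (-1)^* = Ψ`. [folklore] -/
theorem total_iOp (F : MM n Γ) : P.total (iOp n Γ F) = P.total F := by
  rw [iOp, total_gOp, total_apply]
  have h1 : (-1 : SL(2, ℤ))⁻¹ = -1 := by rw [inv_neg, inv_one]
  refine Finset.sum_congr rfl fun x _ ↦ ?_
  rw [h1]
  exact P.sym_neg x (F x)

/-- **The Manin relations are respected**: `rel ≤ ker Ψ`. [folklore] -/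
theorem relK_le_ker : relK n Γ ≤ LinearMap.ker P.total := by
  refine sup_le (sup_le ?_ ?_) ?_
  · rintro _ ⟨F, rfl⟩
    rw [LinearMap.mem_ker, LinearMap.add_apply, LinearMap.id_apply, map_add, total_sOp, add_neg_cancel]
  · rintro _ ⟨F, rfl⟩
    rw [LinearMap.mem_ker, LinearMap.add_apply, LinearMap.add_apply, LinearMap.id_apply,
      LinearMap.comp_apply, map_add, map_add]
    exact P.total_uOp F
  · rintro _ ⟨F, rfl⟩
    rw [LinearMap.mem_ker, LinearMap.sub_apply, LinearMap.id_apply, map_sub, total_iOp, sub_self]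

open scoped Classical in
/-- `Ψ(e_x ⊗ ev_q) = [x, q]`. [folklore] -/
theorem total_single (x : Coset Γ) (q : Fin 2 → ℤ) :
    P.total (Pi.single x (ev n q)) = P.toFun x q := by
  rw [total_apply, Finset.sum_eq_single x (fun y _ hy ↦ by rw [Pi.single_eq_of_ne hy, map_zero])
    (fun h ↦ absurd (Finset.mem_univ x) h), Pi.single_eq_same, sym_ev]

/-- **The span of a system of Manin symbols has dimension at most `dim M/rel`.** [folklore] -/
theorem finrank_span_le :
    finrank ℚ (Submodule.span ℚ (Set.range fun xq : Coset Γ × (Fin 2 → ℤ) ↦ P.toFun xq.1 xq.2)) ≤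
      finrank ℚ (MM n Γ ⧸ relK n Γ) := by
  classical
  set L := (relK n Γ).liftQ P.total P.relK_le_ker
  have hle : Submodule.span ℚ (Set.range fun xq : Coset Γ × (Fin 2 → ℤ) ↦ P.toFun xq.1 xq.2) ≤
      LinearMap.range L := by
    rw [Submodule.span_le]
    rintro _ ⟨⟨x, q⟩, rfl⟩
    exact ⟨Submodule.Quotient.mk (Pi.single x (ev n q)), by
      rw [Submodule.liftQ_apply, total_single]⟩
  calc finrank ℚ (Submodule.span ℚ (Set.range fun xq : Coset Γ × (Fin 2 → ℤ) ↦ P.toFun xq.1 xq.2))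
      ≤ finrank ℚ (LinearMap.range L) :=
        LinearMap.finrank_le_finrank_of_injective (f := Submodule.inclusion hle)
          (Submodule.inclusion_injective hle)
    _ ≤ finrank ℚ (MM n Γ ⧸ relK n Γ) := LinearMap.finrank_range_le L

end PolySymbol

/-! ### The count for `Γ` without elliptic elements and without `-1` -/

/-- **The dimension bound for the weight-`(n + 2)` Manin symbols of `Γ`**: if `n ≥ 1` and no
conjugate of `-1`, `±S`, `±TS`, `±(TS)²` lies in `Γ` (no `-1`, no elliptic elements), then
`12 dim_ℚ (M/rel) ≤ (n + 1) [SL(2, ℤ) : Γ]` (Merel 1994, Prop. 3: `dim M_k(Γ)` = `dim` of the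
`J`-coinvariants minus the `σ`- and `τ`-invariants, `k > 2`; the value `(n+1)μ̄/6` is Shimura's
(8.2.24) for `dim H¹_P` plus one boundary class per cusp). [cite: Merel1994, §1.3 Prop. 3] -/
theorem twelve_mul_finrank_quotient_le [Γ.FiniteIndex] (hn : 1 ≤ n)
    (hfree : ∀ g ∈ ({-1, S, -S, T * S, -(T * S), T * S * (T * S), -(T * S * (T * S))} :
      Set SL(2, ℤ)), ∀ x : Coset Γ, g • x ≠ x) :
    12 * finrank ℚ (MM n Γ ⧸ relK n Γ) ≤ (n + 1) * Γ.index := by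
  classical
  have h := (isSixTerm n Γ).twelve_mul_finrank_quotient_le
  rw [fix_eq_bot n Γ hn, finrank_bot] at h
  have key : ∀ g ∈ ({-1, S, -S, T * S, -(T * S), T * S * (T * S), -(T * S * (T * S))} :
      Set SL(2, ℤ)), LinearMap.trace ℚ (MM n Γ) (gOp n Γ g) = 0 :=
    fun g hg ↦ trace_gOp_eq_zero n Γ g (hfree g hg)
  have t1 : LinearMap.trace ℚ (MM n Γ) (iOp n Γ) = 0 := key (-1) (by simp)
  have t2 : LinearMap.trace ℚ (MM n Γ) (sOp n Γ) = 0 := key S (by simp)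
  have t3 : LinearMap.trace ℚ (MM n Γ) (sOp n Γ ∘ₗ iOp n Γ) = 0 := by
    rw [sOp, iOp, ← gOp_mul, neg_one_mul]
    exact key (-S) (by simp)
  have t4 : LinearMap.trace ℚ (MM n Γ) (uOp n Γ) = 0 := key (T * S) (by simp)
  have t5 : LinearMap.trace ℚ (MM n Γ) (uOp n Γ ∘ₗ iOp n Γ) = 0 := by
    rw [uOp, iOp, ← gOp_mul, neg_one_mul]
    exact key (-(T * S)) (by simp)
  have t6 : LinearMap.trace ℚ (MM n Γ) (uOp n Γ ∘ₗ uOp n Γ) = 0 := by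
    rw [uOp, ← gOp_mul]
    exact key (T * S * (T * S)) (by simp)
  have t7 : LinearMap.trace ℚ (MM n Γ) ((uOp n Γ ∘ₗ uOp n Γ) ∘ₗ iOp n Γ) = 0 := by
    rw [uOp, iOp, ← gOp_mul, ← gOp_mul, neg_one_mul]
    exact key (-(T * S * (T * S))) (by simp)
  rw [t1, t2, t3, t4, t5, t6, t7] at h
  have hM : (finrank ℚ (MM n Γ) : ℚ) ≤ (n + 1) * Γ.index := by
    have e1 : finrank ℚ (MM n Γ) = ∑ _x : Coset Γ, finrank ℚ (V n) := Module.finrank_pi_fintype ℚ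
    rw [Finset.sum_const, Finset.card_univ, smul_eq_mul, Subspace.dual_finrank_eq] at e1
    have e2 := finrank_polyFun_le n
    have e3 : Fintype.card (Coset Γ) = Γ.index := by
      rw [Subgroup.index, Nat.card_eq_fintype_card]
    have : finrank ℚ (MM n Γ) ≤ (n + 1) * Γ.index := by
      rw [e1, ← e3, mul_comm]
      exact Nat.mul_le_mul_right _ e2
    exact_mod_cast this
  change 12 * (finrank ℚ (MM n Γ ⧸ relK n Γ) : ℚ) ≤ _ at h
  simp only [Nat.cast_zero, mul_zero, add_zero, sub_zero] at h
  have : (12 * finrank ℚ (MM n Γ ⧸ relK n Γ) : ℚ) ≤ (n + 1) * Γ.index := h.trans hM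
  exact_mod_cast this

/-- **Rank bound for systems of Manin symbols**: for `n ≥ 1` and `Γ` without `-1` and elliptic
elements, any system of weight-`(n + 2)` Manin symbols spans a space of dimension `D` with
`12 D ≤ (n + 1)[SL(2, ℤ) : Γ]`. [cite: Merel1994, §1.3 Prop. 3] -/
theorem PolySymbol.twelve_mul_finrank_span_le [Γ.FiniteIndex] (P : PolySymbol n Γ E) (hn : 1 ≤ n)
    (hfree : ∀ g ∈ ({-1, S, -S, T * S, -(T * S), T * S * (T * S), -(T * S * (T * S))} :
      Set SL(2, ℤ)), ∀ x : Coset Γ, g • x ≠ x) :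
    12 * finrank ℚ (Submodule.span ℚ (Set.range fun xq : Coset Γ × (Fin 2 → ℤ) ↦ P.toFun xq.1 xq.2))
      ≤ (n + 1) * Γ.index :=
  (Nat.mul_le_mul_left 12 P.finrank_span_le).trans (twelve_mul_finrank_quotient_le n Γ hn hfree)

end ManinK

end Literature.NumberTheory.EllipticCurves.ModularForms
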